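import Literature.NumberTheory.EllipticCurves.Gamma0RankinSelbergResidueWeight
import Literature.NumberTheory.EllipticCurves.CongruenceNumber
import Literature.NumberTheory.EllipticCurves.CuspFormLFunctionFrickeProofs
import HarnessLib

/-!
# The Rankin–Selberg residue for the Petersson pairing `⟨f, g⟩` on `Γ₀(N)`

Topic `Literature/NumberTheory/EllipticCurves`; theorems only (no definition, no named fact). The
bilinear (pairing) form of the Rankin–Selberg residue identity of
`Gamma0RankinSelbergResidueWeight.lean`: for cusp forms `f, g ∈ S_k(Γ₀(N))`, `k ≥ 0`, `N ≥ 1`,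
with Fourier coefficients `aₙ = cuspCoeff f n`, `bₙ = cuspCoeff g n` and the tree's un-normalised
Petersson product `⟨f, g⟩ = peterssonProduct (Γ₀(N)) k f g = ∫_{Γ₀(N)\\ℍ} conj(f) g yᵏ dμ`
(conjugate-linear in `f`, `HeckeOperators.lean`):

  `lim_{s → 1⁺} (s − 1) · Σₙ conj(aₙ) bₙ Γ(s+k−1) (4πn)^{-(s+k−1)} = 3 ⟨f, g⟩ / (π [SL₂(ℤ) : Γ₀(N)])`

(`tendsto_sub_one_mul_tsum_conj_cuspCoeff_mul_cuspCoeff`). In particular the "residue" vanishes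
when `⟨f, g⟩ = 0` — the residue form of Murty's Lemma 9 (*Bounds for congruence primes*, §6:
"`½ Σ_{n≤x} |aₙ(f)|² log²(x/n) = c(f)x² + O(x^{3/2}N^{1+ε})` … If `g` is another newform
orthogonal to `f`, then `½ Σ_{n≤x} aₙ(f) āₙ(g) log²(x/n) = O(x^{3/2}N^{1+ε})`"; the error terms,
which need the analytic continuation of the Rankin–Selberg convolution, are not formalised) and of
Bump, *Automorphic forms and representations*, Thm. 1.6.2 (`Res_{s=k} Λ(s, f × ḡ) = ½π^{1−k}⟨f, g⟩`,
level `1`). Also recorded: the summability of `Σ |aₙ|² Γ(s+k−1)(4πn)^{-(s+k−1)}` for `1 < s < 3`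
(`summable_normSq_cuspCoeff_mul_rpow`, i.e. convergence of Rankin's series `Σ|aₙ|²n^{-w}` for
`k < w < k + 2`) and its pole at the edge, `Σ|aₙ|² n^{-w} → +∞` as `w → k⁺` for `f ≠ 0`
(`tendsto_tsum_normSq_cuspCoeff_div_rpow_atTop`, from the positivity `⟨f,f⟩ > 0`).

## Proof

Polarisation. For a form `B` conjugate-linear in the first and linear in the second variable,
`4 B(f, g) = B(f+g, f+g) − B(f−g, f−g) − i B(f+ig, f+ig) + i B(f−ig, f−ig)`; this is applied to
`B = ⟨·, ·⟩` (`peterssonProduct_polarization`, from the tree's `peterssonProduct_add_left/right`,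
`peterssonProduct_smul_left/right`) and to `B(a, b) = conj(a) b` on the coefficients
(`conj_mul_eq_polarization`, with `aₙ(f + c g) = aₙ(f) + c aₙ(g)`), and the four resulting norm
identities are instances of the weight-`k` residue theorem
`tendsto_sub_one_mul_tsum_normSq_cuspCoeff_weight`. Splitting the series termwise needs their
summability for `s > 1` (the Rankin–Selberg range `k < Re w ≤ k + 1` of `Σ|aₙ|² n^{-w}`, beyond the
reach of the Hecke bound): it is read off from the strip identity
`∫_{0≤Re<1} |f|² yᵃ dμ = Σ |aₙ|² Γ(a−1)(4πn)^{1−a}` (`RankinSelbergStripIntegral.lean`) and the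
finiteness of that integral for `k + 1 < a < k + 3` (`lintegral_strip_normSq_mul_rpow_lt_top`:
`|f|² yᵃ⁻² ≤ min(B yᵃ⁻ᵏ⁻², M yᵃ⁻ᵏ⁻⁴)` from the Petersson bound `|f|²yᵏ ≤ B` and the bound
`|f|² yᵏ⁺² ≤ M` of the weight-`k` file).

## References

* M. R. Murty, *Bounds for congruence primes*, Proc. Sympos. Pure Math. 66.1 (1999) 177–192, §6,
  Lemma 9 (read in the author's preprint `degree.dvi`, p. 10). [Murty1999CongruencePrimes]
* D. Bump, *Automorphic forms and representations* (1997), Thm. 1.6.2. [Bump1997]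
* R. A. Rankin, Proc. Cambridge Philos. Soc. 35 (1939) 357–372. [Rankin1939]
-/

noncomputable section

open scoped MatrixGroups ModularForm Modular Real Topology ENNReal NNReal ComplexConjugate
open UpperHalfPlane hiding I
open MeasureTheory Set Filter Asymptotics ModularGroup ConjAct Pointwise CongruenceSubgroup
open Literature.NumberTheory.Automorphic

namespace Literature.NumberTheory.EllipticCurves.ModularForms

/-! ### Finiteness of the strip integral and summability in the Rankin–Selberg range -/

section StripFinite

variable {Γ : Subgroup (GL (Fin 2) ℝ)} [Γ.IsArithmetic] {k : ℤ}

/-- The Petersson bound as a real inequality: `|f(z)|² (Im z)ᵏ ≤ B` on `ℍ` for a cusp form of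
arithmetic level (Mathlib `CuspFormClass.petersson_bounded_left`). [folklore] -/
theorem exists_normSq_mul_im_zpow_le (f : CuspForm Γ k) : ∃ B : ℝ, ∀ z : ℍ, ‖f z‖ ^ 2 * z.im ^ k ≤ B := by
  obtain ⟨B, hB⟩ := CuspFormClass.petersson_bounded_left k Γ f f
  refine ⟨B, fun z ↦ ?_⟩
  have h := hB z
  rw [petersson_self_eq_ofReal, Complex.norm_real, Real.norm_of_nonneg
    (mul_nonneg (sq_nonneg _) (zpow_nonneg z.im_pos.le _))] at h
  exact h

/-- **Finiteness of the strip integral in the Rankin–Selberg range**: for a cusp form `f` of weight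
`k` and arithmetic level and `k + 1 < a < k + 3`, `∫_{0 ≤ Re ρ < 1} |f(ρ)|² (Im ρ)ᵃ dμ(ρ) < ∞`.
In coordinates the integrand is `|f|² yᵃ⁻²`, at most `B yᵃ⁻ᵏ⁻²` (Petersson bound, integrable on
`(0, 1]` as `a − k − 2 > −1`) and at most `M yᵃ⁻ᵏ⁻⁴` (`exists_normSq_mul_im_zpow_mul_sq_le`,
integrable on `(1, ∞)` as `a − k − 4 < −1`). [folklore] -/
theorem lintegral_strip_normSq_mul_rpow_lt_top (f : CuspForm Γ k) {a : ℝ}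
    (h1 : (k : ℝ) + 1 < a) (h2 : a < k + 3) :
    ∫⁻ ρ in {ρ : ℍ | 0 ≤ ρ.re ∧ ρ.re < 1}, ENNReal.ofReal (‖f ρ‖ ^ 2 * ρ.im ^ a) < ∞ := by
  obtain ⟨B, hB⟩ := exists_normSq_mul_im_zpow_le f
  obtain ⟨M, hM⟩ := exists_normSq_mul_im_zpow_mul_sq_le f
  set F : ℂ → ℝ≥0∞ := fun w ↦ ENNReal.ofReal (‖f (ofComplex w)‖ ^ 2 * w.im ^ a) with hFdef
  have hF : Measurable F :=
    ((((ModularFormClass.continuous f).measurable.comp measurable_ofComplex).norm.pow_const 2).mul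
      (Complex.measurable_im.pow_const a)).ennreal_ofReal
  have e0 : ∫⁻ ρ in {ρ : ℍ | 0 ≤ ρ.re ∧ ρ.re < 1}, ENNReal.ofReal (‖f ρ‖ ^ 2 * ρ.im ^ a) =
      ∫⁻ ρ in {ρ : ℍ | 0 ≤ ρ.re ∧ ρ.re < 1}, F ρ := by
    refine lintegral_congr fun ρ ↦ ?_
    rw [hFdef]
    dsimp only
    rw [ofComplex_apply, UpperHalfPlane.coe_im]
  rw [e0, lintegral_strip_eq_lintegral_Ioi_Ico F hF]
  -- the majorant
  set m : ℝ → ℝ := fun y ↦ min (B * y ^ (a - k - 2)) (M * y ^ (a - k - 4)) with hm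
  have hpt : ∀ y : ℝ, 0 < y → ∀ x : ℝ, F ⟨x, y⟩ * ENNReal.ofReal (1 / y ^ 2) ≤ ENNReal.ofReal (m y) := by
    intro y hy x
    have hz : ofComplex (⟨x, y⟩ : ℂ) = ⟨⟨x, y⟩, hy⟩ := ofComplex_apply_of_im_pos hy
    set z : ℍ := ⟨⟨x, y⟩, hy⟩ with hzdef
    have him : z.im = y := rfl
    rw [hFdef]
    dsimp only
    rw [hz, ← ENNReal.ofReal_mul (by positivity)]
    refine ENNReal.ofReal_le_ofReal ?_
    have hyk : 0 < y ^ k := zpow_pos hy k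
    have e1 : y ^ (a - k - 2) = y ^ a / (y ^ k * y ^ 2) := by
      rw [show a - k - 2 = a - ((k : ℝ) + 2) by ring, Real.rpow_sub hy, Real.rpow_add hy,
        Real.rpow_intCast, Real.rpow_two]
    have e2 : y ^ (a - k - 4) = y ^ a / (y ^ k * y ^ 2 * y ^ 2) := by
      rw [show a - k - 4 = a - ((k : ℝ) + 2 + 2) by ring, Real.rpow_sub hy, Real.rpow_add hy,
        Real.rpow_add hy, Real.rpow_intCast, Real.rpow_two]
    rw [hm]
    refine le_min ?_ ?_
    · have h := mul_le_mul_of_nonneg_right (hB z) (Real.rpow_nonneg hy.le (a - k - 2))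
      rw [him] at h
      calc ‖f z‖ ^ 2 * y ^ a * (1 / y ^ 2) = ‖f z‖ ^ 2 * y ^ k * y ^ (a - k - 2) := by
            rw [e1]; field_simp
        _ ≤ B * y ^ (a - k - 2) := h
    · have h := mul_le_mul_of_nonneg_right (hM z) (Real.rpow_nonneg hy.le (a - k - 4))
      rw [him] at h
      calc ‖f z‖ ^ 2 * y ^ a * (1 / y ^ 2) = ‖f z‖ ^ 2 * y ^ k * y ^ 2 * y ^ (a - k - 4) := by
            rw [e2]; field_simp
        _ ≤ M * y ^ (a - k - 4) := h
  -- bound the iterated integral by `∫₀^∞ m`, split at `y = 1`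
  have hle : ∫⁻ y in Ioi (0 : ℝ), ∫⁻ x in Ico (0 : ℝ) 1, F ⟨x, y⟩ * ENNReal.ofReal (1 / y ^ 2) ≤
      ∫⁻ y in Ioi (0 : ℝ), ENNReal.ofReal (m y) := by
    refine setLIntegral_mono' measurableSet_Ioi fun y hy ↦ ?_
    rw [mem_Ioi] at hy
    calc ∫⁻ x in Ico (0 : ℝ) 1, F ⟨x, y⟩ * ENNReal.ofReal (1 / y ^ 2)
        ≤ ∫⁻ _ in Ico (0 : ℝ) 1, ENNReal.ofReal (m y) := lintegral_mono fun x ↦ hpt y hy x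
      _ = ENNReal.ofReal (m y) := by
          rw [lintegral_const, Measure.restrict_apply_univ, Real.volume_Ico, sub_zero,
            ENNReal.ofReal_one, mul_one]
  refine lt_of_le_of_lt hle ?_
  rw [← Ioc_union_Ioi_eq_Ioi zero_le_one, lintegral_union measurableSet_Ioi (Ioc_disjoint_Ioi le_rfl)]
  refine ENNReal.add_lt_top.mpr ⟨?_, ?_⟩
  · -- `(0, 1]`: `m ≤ B y^{a-k-2}`, exponent `> -1`
    have hint : IntegrableOn (fun y : ℝ ↦ B * y ^ (a - k - 2)) (Ioc 0 1) :=
      ((intervalIntegral.intervalIntegrable_rpow' (a := 0) (b := 1)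
        (show -1 < a - k - 2 by linarith)).1).const_mul B
    calc ∫⁻ y in Ioc (0 : ℝ) 1, ENNReal.ofReal (m y)
        ≤ ∫⁻ y in Ioc (0 : ℝ) 1, ENNReal.ofReal (B * y ^ (a - k - 2)) :=
          lintegral_mono fun y ↦ ENNReal.ofReal_le_ofReal (min_le_left _ _)
      _ < ∞ := hint.setLIntegral_lt_top
  · -- `(1, ∞)`: `m ≤ M y^{a-k-4}`, exponent `< -1`
    have hint : IntegrableOn (fun y : ℝ ↦ M * y ^ (a - k - 4)) (Ioi 1) :=
      (integrableOn_Ioi_rpow_of_lt (show a - k - 4 < -1 by linarith) zero_lt_one).const_mul M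
    calc ∫⁻ y in Ioi (1 : ℝ), ENNReal.ofReal (m y)
        ≤ ∫⁻ y in Ioi (1 : ℝ), ENNReal.ofReal (M * y ^ (a - k - 4)) :=
          lintegral_mono fun y ↦ ENNReal.ofReal_le_ofReal (min_le_right _ _)
      _ < ∞ := hint.setLIntegral_lt_top

variable {N : ℕ} [NeZero N]

/-- **Summability in the Rankin–Selberg range**: for `f ∈ S_k(Γ₀(N))`, `k ≥ 0`, and `1 < s < 3`,
the series `Σₙ |aₙ|² Γ(s+k−1) (4πn)^{-(s+k−1)}` converges (equivalently `Σ |aₙ|² n^{-w}` converges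
for `k < w < k + 2`; Rankin 1939 — beyond `w > k + 1`, which is all the Hecke bound `aₙ = O(n^{k/2})`
gives): the strip identity `lintegral_strip_normSq_mul_rpow` and
`lintegral_strip_normSq_mul_rpow_lt_top`. [cite: Rankin1939, convergence of Σ|aₙ|²n^{-s} for Re s > k] -/
theorem summable_normSq_cuspCoeff_mul_rpow (hk : 0 ≤ k) (f : CuspForm (Gamma0 N) k) {s : ℝ}
    (hs1 : 1 < s) (hs3 : s < 3) :
    Summable fun n : ℕ ↦ ‖cuspCoeff f n‖ ^ 2 * ((1 / (4 * π * n)) ^ (s + k - 1) * Real.Gamma (s + k - 1)) := by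
  have hΓ : (1 : ℝ) ∈ (Gamma0 N : Subgroup (GL (Fin 2) ℝ)).strictPeriods :=
    strictWidthInfty_Gamma0 N ▸ Subgroup.strictWidthInfty_mem_strictPeriods _
  have hkr : (0 : ℝ) ≤ k := by exact_mod_cast hk
  have hfin := lintegral_strip_normSq_mul_rpow_lt_top f (a := s + k) (by linarith) (by linarith)
  rw [lintegral_strip_normSq_mul_rpow hΓ f (a := s + k) (by linarith)] at hfin
  have hsum := ENNReal.summable_toReal hfin.ne
  refine hsum.congr fun n ↦ ?_
  refine ENNReal.toReal_ofReal ?_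
  have : 0 < Real.Gamma (s + k - 1) := Real.Gamma_pos_of_pos (by linarith)
  positivity

end StripFinite

/-! ### Polarisation -/

section Polarization

/-- Polarisation for `conj(a) b`: `4 conj(a) b = |a+b|² − |a−b|² − i(|a+ib|² − |a−ib|²)`. [folklore] -/
theorem conj_mul_eq_polarization (a b : ℂ) :
    conj a * b = (((‖a + b‖ ^ 2 - ‖a + (-1 : ℂ) * b‖ ^ 2 : ℝ) : ℂ) -
      Complex.I * ((‖a + Complex.I * b‖ ^ 2 - ‖a + (-Complex.I) * b‖ ^ 2 : ℝ) : ℂ)) / 4 := by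
  simp only [Complex.sq_norm]
  apply Complex.ext
  · simp [Complex.normSq_apply]
    ring
  · simp [Complex.normSq_apply]
    ring

variable (Γ : Subgroup (GL (Fin 2) ℝ)) [Γ.IsArithmetic] [Γ.HasDetOne] (k : ℤ)

/-- **Polarisation of the Petersson product**:
`4 ⟨f, g⟩ = ⟨f+g, f+g⟩ − ⟨f−g, f−g⟩ − i⟨f+ig, f+ig⟩ + i⟨f−ig, f−ig⟩` (the product is
conjugate-linear in the first and linear in the second variable: the tree's
`peterssonProduct_add_left/right`, `peterssonProduct_smul_left/right`; Diamond–Shurman §5.4). [folklore] -/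
theorem peterssonProduct_polarization (f g : CuspForm Γ k) :
    peterssonProduct Γ k f g =
      (peterssonProduct Γ k (f + g) (f + g) - peterssonProduct Γ k (f + (-1 : ℂ) • g) (f + (-1 : ℂ) • g) -
        Complex.I * (peterssonProduct Γ k (f + Complex.I • g) (f + Complex.I • g) -
          peterssonProduct Γ k (f + (-Complex.I) • g) (f + (-Complex.I) • g))) / 4 := by
  have hexp : ∀ c : ℂ, peterssonProduct Γ k (f + c • g) (f + c • g) =
      peterssonProduct Γ k f f + c * peterssonProduct Γ k f g + conj c * peterssonProduct Γ k g f +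
        conj c * c * peterssonProduct Γ k g g := by
    intro c
    rw [peterssonProduct_add_left Γ k, peterssonProduct_add_right k, peterssonProduct_add_right k,
      peterssonProduct_smul_right Γ k, peterssonProduct_smul_left Γ k, peterssonProduct_smul_left Γ k,
      peterssonProduct_smul_right Γ k]
    ring
  rw [hexp, hexp, hexp]
  have h1 : peterssonProduct Γ k (f + g) (f + g) =
      peterssonProduct Γ k f f + peterssonProduct Γ k f g + peterssonProduct Γ k g f +
        peterssonProduct Γ k g g := by
    have h := hexp 1
    rw [one_smul] at h
    rw [h, map_one]
    ring
  rw [h1, map_neg, map_one, Complex.conj_I, map_neg, Complex.conj_I, neg_neg]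
  have hI : Complex.I * Complex.I = -1 := Complex.I_mul_I
  linear_combination ((1 : ℂ) / 2 * (peterssonProduct Γ k f g - peterssonProduct Γ k g f)) * hI

end Polarization

/-! ### The pairing form of the residue identity -/

section Pairing

variable {N : ℕ} [NeZero N] {k : ℤ}

omit [NeZero N] in
/-- `aₙ(f + c g) = aₙ(f) + c aₙ(g)` on `Γ₀(N)` (`cuspCoeff_add_form`, `cuspCoeff_smul`). [folklore] -/
theorem cuspCoeff_add_smul (f g : CuspForm (Gamma0 N) k) (c : ℂ) (n : ℕ) :
    cuspCoeff (f + c • g) n = cuspCoeff f n + c * cuspCoeff g n := by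
  have hΓ : (1 : ℝ) ∈ (Gamma0 N : Subgroup (GL (Fin 2) ℝ)).strictPeriods :=
    strictWidthInfty_Gamma0 N ▸ Subgroup.strictWidthInfty_mem_strictPeriods _
  rw [cuspCoeff_add_form hΓ, cuspCoeff_smul]

/-- **The Rankin–Selberg residue for the Petersson pairing on `Γ₀(N)`, weight `k ≥ 0`.** For cusp
forms `f, g ∈ S_k(Γ₀(N))`, `N ≥ 1`, with `aₙ = cuspCoeff f n`, `bₙ = cuspCoeff g n`:
`(s − 1) · Σₙ conj(aₙ) bₙ Γ(s+k−1) (4πn)^{-(s+k−1)} → 3 ⟨f, g⟩ / (π · gamma0Index N)` as `s → 1⁺`,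
where `⟨f, g⟩ = peterssonProduct (Γ₀(N)) k f g` (un-normalised, conjugate-linear in `f`); in
particular the limit is `0` when `f ⊥ g` (Murty 1999, Lemma 9, residue form; Bump Thm. 1.6.2 for
level `1`). By polarisation from the norm case `tendsto_sub_one_mul_tsum_normSq_cuspCoeff_weight`.
[cite: Murty1999CongruencePrimes, §6 Lemma 9 (main terms c(f)x² and 0 for g ⊥ f); Bump1997, Thm. 1.6.2] -/
theorem tendsto_sub_one_mul_tsum_conj_cuspCoeff_mul_cuspCoeff (hk : 0 ≤ k) (f g : CuspForm (Gamma0 N) k) :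
    Tendsto (fun s : ℝ ↦ ((s - 1 : ℝ) : ℂ) * ∑' n : ℕ, conj (cuspCoeff f n) * cuspCoeff g n *
        (((1 / (4 * π * n)) ^ (s + k - 1) * Real.Gamma (s + k - 1) : ℝ) : ℂ))
      (𝓝[>] 1) (𝓝 (3 * peterssonProduct (Gamma0 N) k f g / (π * gamma0Index N))) := by
  -- notation
  set φ : ℕ → ℝ → ℝ := fun n s ↦ (1 / (4 * π * n)) ^ (s + k - 1) * Real.Gamma (s + k - 1) with hφ
  set T : CuspForm (Gamma0 N) k → ℝ → ℝ := fun h s ↦ (s - 1) * ∑' n : ℕ, ‖cuspCoeff h n‖ ^ 2 * φ n s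
    with hT
  set P : CuspForm (Gamma0 N) k → CuspForm (Gamma0 N) k → ℂ := fun h h' ↦ peterssonProduct (Gamma0 N) k h h'
    with hP
  set ν : ℝ := π * gamma0Index N with hν
  -- the four norm limits, cast to `ℂ`
  have hlim : ∀ h : CuspForm (Gamma0 N) k,
      Tendsto (fun s : ℝ ↦ ((T h s : ℝ) : ℂ)) (𝓝[>] 1) (𝓝 ((3 : ℂ) * P h h / ν)) := by
    intro h
    have h1 := tendsto_sub_one_mul_tsum_normSq_cuspCoeff_weight hk h
    have h2 := (Complex.continuous_ofReal.tendsto _).comp h1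
    have hval : (((3 * (peterssonProduct (Gamma0 N) k h h).re / (π * gamma0Index N)) : ℝ) : ℂ) =
        (3 : ℂ) * P h h / ν := by
      rw [hP, hν]
      dsimp only
      -- `⟨h, h⟩` is real (Hermitian symmetry; the named version is `peterssonProduct_self_eq_ofReal`
      -- in `PeriodRationalityProofs.lean`, not imported here to keep the import closure small)
      have hre : peterssonProduct (Gamma0 N) k h h = ((peterssonProduct (Gamma0 N) k h h).re : ℂ) :=
        (Complex.conj_eq_iff_re.mp (peterssonProduct_conj_symm_holds (Gamma0 N) k h h).symm).symm
      rw [hre]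
      push_cast
      rw [Complex.ofReal_re]
    rw [hval] at h2
    exact h2
  -- the combination
  set h₁ := f + g with hh₁
  set h₂ := f + (-1 : ℂ) • g with hh₂
  set h₃ := f + Complex.I • g with hh₃
  set h₄ := f + (-Complex.I) • g with hh₄
  have hcomb : Tendsto (fun s : ℝ ↦ (((T h₁ s : ℝ) : ℂ) - ((T h₂ s : ℝ) : ℂ) -
      Complex.I * (((T h₃ s : ℝ) : ℂ) - ((T h₄ s : ℝ) : ℂ))) / 4) (𝓝[>] 1)
      (𝓝 (((3 : ℂ) * P h₁ h₁ / ν - (3 : ℂ) * P h₂ h₂ / ν -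
        Complex.I * ((3 : ℂ) * P h₃ h₃ / ν - (3 : ℂ) * P h₄ h₄ / ν)) / 4)) :=
    (((hlim h₁).sub (hlim h₂)).sub (((hlim h₃).sub (hlim h₄)).const_mul Complex.I)).div_const 4
  -- its limit is `3 ⟨f, g⟩ / ν`
  have hval : ((3 : ℂ) * P h₁ h₁ / ν - (3 : ℂ) * P h₂ h₂ / ν -
      Complex.I * ((3 : ℂ) * P h₃ h₃ / ν - (3 : ℂ) * P h₄ h₄ / ν)) / 4 =
      3 * peterssonProduct (Gamma0 N) k f g / (π * gamma0Index N) := by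
    simp only [hP, hν, hh₁, hh₂, hh₃, hh₄]
    rw [peterssonProduct_polarization (Gamma0 N) k f g]
    push_cast
    ring
  rw [hval] at hcomb
  -- and it agrees with the pairing series for `1 < s < 3`
  refine hcomb.congr' ?_
  filter_upwards [Ioo_mem_nhdsGT (show (1 : ℝ) < 3 by norm_num)] with s hs
  -- the four summable real series, cast to `ℂ`
  set A : CuspForm (Gamma0 N) k → ℕ → ℂ := fun h n ↦ ((‖cuspCoeff h n‖ ^ 2 * φ n s : ℝ) : ℂ) with hA
  have hsum : ∀ h : CuspForm (Gamma0 N) k, Summable (A h) := fun h ↦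
    Complex.summable_ofReal.mpr (summable_normSq_cuspCoeff_mul_rpow hk h hs.1 hs.2)
  have hTc : ∀ h : CuspForm (Gamma0 N) k, ((T h s : ℝ) : ℂ) = ((s - 1 : ℝ) : ℂ) * ∑' n : ℕ, A h n := by
    intro h
    rw [hT, hA]
    dsimp only
    rw [Complex.ofReal_mul, Complex.ofReal_tsum]
  -- termwise polarisation
  have key : ∀ n : ℕ, conj (cuspCoeff f n) * cuspCoeff g n * ((φ n s : ℝ) : ℂ) =
      ((A h₁ n - A h₂ n) - Complex.I * (A h₃ n - A h₄ n)) / 4 := by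
    intro n
    rw [hA]
    dsimp only
    rw [hh₁, hh₂, hh₃, hh₄, conj_mul_eq_polarization (cuspCoeff f n) (cuspCoeff g n)]
    have e1 : cuspCoeff (f + g) n = cuspCoeff f n + cuspCoeff g n := by
      have h := cuspCoeff_add_smul f g 1 n
      rw [one_smul, one_mul] at h
      exact h
    rw [e1, cuspCoeff_add_smul, cuspCoeff_add_smul, cuspCoeff_add_smul]
    push_cast
    ring
  have h12 : Summable fun n : ℕ ↦ A h₁ n - A h₂ n := (hsum h₁).sub (hsum h₂)
  have h34 : Summable fun n : ℕ ↦ Complex.I * (A h₃ n - A h₄ n) := ((hsum h₃).sub (hsum h₄)).mul_left _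
  symm
  calc ((s - 1 : ℝ) : ℂ) * ∑' n : ℕ, conj (cuspCoeff f n) * cuspCoeff g n * ((φ n s : ℝ) : ℂ)
      = ((s - 1 : ℝ) : ℂ) * ∑' n : ℕ, ((A h₁ n - A h₂ n) - Complex.I * (A h₃ n - A h₄ n)) / 4 := by
        rw [tsum_congr key]
    _ = ((s - 1 : ℝ) : ℂ) * (((∑' n : ℕ, A h₁ n) - ∑' n : ℕ, A h₂ n) -
          Complex.I * ((∑' n : ℕ, A h₃ n) - ∑' n : ℕ, A h₄ n)) / 4 := by
        rw [tsum_div_const, h12.tsum_sub h34, (hsum h₁).tsum_sub (hsum h₂), tsum_mul_left,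
          (hsum h₃).tsum_sub (hsum h₄), mul_div_assoc]
    _ = (((T h₁ s : ℝ) : ℂ) - ((T h₂ s : ℝ) : ℂ) - Complex.I * (((T h₃ s : ℝ) : ℂ) - ((T h₄ s : ℝ) : ℂ))) / 4 := by
        rw [hTc, hTc, hTc, hTc]
        ring

/-- **Orthogonal forms have vanishing Rankin–Selberg residue** (Murty 1999, Lemma 9, second
part, residue form): if `⟨f, g⟩ = 0` then `(s − 1) Σ conj(aₙ) bₙ Γ(s+k−1)(4πn)^{-(s+k−1)} → 0`
as `s → 1⁺`. [cite: Murty1999CongruencePrimes, §6 Lemma 9 (g orthogonal to f)] -/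
theorem tendsto_sub_one_mul_tsum_conj_cuspCoeff_mul_cuspCoeff_of_orthogonal (hk : 0 ≤ k)
    {f g : CuspForm (Gamma0 N) k} (hfg : peterssonProduct (Gamma0 N) k f g = 0) :
    Tendsto (fun s : ℝ ↦ ((s - 1 : ℝ) : ℂ) * ∑' n : ℕ, conj (cuspCoeff f n) * cuspCoeff g n *
        (((1 / (4 * π * n)) ^ (s + k - 1) * Real.Gamma (s + k - 1) : ℝ) : ℂ))
      (𝓝[>] 1) (𝓝 0) := by
  have h := tendsto_sub_one_mul_tsum_conj_cuspCoeff_mul_cuspCoeff hk f g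
  rw [hfg, mul_zero, zero_div] at h
  exact h

end Pairing

/-! ### The pole at the edge of convergence -/

section Pole

variable {N : ℕ} [NeZero N] {k : ℤ}

/-- **Rankin: `Σ |aₙ|² n^{-w}` has a genuine pole at `w = k`.** For a nonzero cusp form
`f ∈ S_k(Γ₀(N))`, `k ≥ 1`, `Σₙ |aₙ|² n^{-w} → +∞` as `w → k⁺`: the residue
`3(4π)ᵏ Re(f,f)/(π Γ(k) [SL₂(ℤ):Γ₀(N)])` in `tendsto_sub_weight_mul_tsum_normSq_cuspCoeff_div_rpow`
is positive by the tree's `peterssonProduct_self_pos_holds`. Together with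
`summable_normSq_cuspCoeff_mul_rpow` (convergence for `k < w < k + 2`) this places the abscissa of
convergence of Rankin's series exactly at `w = k`. [cite: Rankin1939, Σ|aₙ|²n^{-s} converges for Re s > k and has a pole at s = k] -/
theorem tendsto_tsum_normSq_cuspCoeff_div_rpow_atTop (hk : 1 ≤ k) {f : CuspForm (Gamma0 N) k}
    (hf : f ≠ 0) :
    Tendsto (fun w : ℝ ↦ ∑' n : ℕ, ‖cuspCoeff f n‖ ^ 2 / (n : ℝ) ^ w) (𝓝[>] (k : ℝ)) atTop := by
  have hT := tendsto_sub_weight_mul_tsum_normSq_cuspCoeff_div_rpow hk f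
  have hpos : 0 < 3 * (peterssonProduct (Gamma0 N) k f f).re / (π * gamma0Index N) *
      ((4 * π) ^ k / Real.Gamma k) := by
    have h1 : 0 < (peterssonProduct (Gamma0 N) k f f).re := peterssonProduct_self_pos_holds (Gamma0 N) k hf
    have h2 : 0 < (gamma0Index N : ℝ) := by exact_mod_cast gamma0Index_pos N
    have hk0 : (0 : ℝ) < k := by exact_mod_cast hk
    have h3 : 0 < Real.Gamma k := Real.Gamma_pos_of_pos hk0
    have h4 : (0 : ℝ) < (4 * π) ^ k := zpow_pos (by positivity) k
    positivity
  have hinv : Tendsto (fun w : ℝ ↦ (w - k)⁻¹) (𝓝[>] (k : ℝ)) atTop := by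
    have h := ((continuous_sub_right (k : ℝ)).continuousWithinAt (s := Set.Ioi (k : ℝ))
      (x := (k : ℝ))).tendsto_nhdsWithin (t := Set.Ioi (0 : ℝ))
      (fun w hw ↦ by simp only [Set.mem_Ioi] at hw ⊢; linarith)
    rw [sub_self] at h
    exact tendsto_inv_nhdsGT_zero.comp h
  refine (hT.pos_mul_atTop hpos hinv).congr' ?_
  filter_upwards [self_mem_nhdsWithin] with w hw
  simp only [Set.mem_Ioi] at hw
  have hne : w - k ≠ 0 := sub_ne_zero.mpr hw.ne'
  rw [mul_comm (w - k), mul_inv_cancel_right₀ hne]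

end Pole

end Literature.NumberTheory.EllipticCurves.ModularForms

end
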